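import Mathlib.NumberTheory.NumberField.AdeleRing
import Mathlib.NumberTheory.NumberField.InfiniteAdeleRing
import Mathlib.NumberTheory.NumberField.CanonicalEmbedding.Basic
import Mathlib.Topology.Algebra.RestrictedProduct.Basic
import Mathlib.Topology.Algebra.RestrictedProduct.TopologicalSpace
import Mathlib.LinearAlgebra.Matrix.GeneralLinearGroup.Defs
import Mathlib.Topology.Algebra.Group.Matrix
import Mathlib.Topology.Algebra.Group.Quotient
import Mathlib.Topology.Algebra.Constructions
import Mathlib.MeasureTheory.Constructions.BorelSpace.Basic
import Mathlib.MeasureTheory.Group.Action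
import Mathlib.MeasureTheory.Measure.Regular
import Mathlib.MeasureTheory.Measure.OpenPos
import HarnessLib

-- provenance: harness21/H21/H21/Prelude/AutomorphicAxiomatic/AdelicGroupData.lean @ d79b28a (interim HEAD d8f2665); M5 mechanical rewrite
/-!
# Axiomatic adelic group data and the automorphic quotient

Trunk `AutomorphicAxiomatic` (G19), item C9 `AdelicGroupData`.

This file provides the *global* half of the axiomatic datum of a connected reductive group over a
number field `K` used throughout the automorphic trunk: a structure `AdelicGroupData K` bundling

* the group of rational points `G(K)` (`Rational`),
* the topological group of adelic points `G(𝔸_K)` (`Adelic`) with `G(K) → G(𝔸_K)`,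
* the local groups `G(K_v)` at finite places `v` with continuous projections `G(𝔸_K) → G(K_v)`,
* a *split central subgroup* `A_G ≤ Z(G(𝔸_K))` (`center'`).

From this we build the **automorphic quotient**
`automorphicQuotient 𝒢 := G(𝔸_K) ⧸ (A_G · G(K))` (a left-coset space in Mathlib's convention
`G ⧸ H`, so *automorphic functions are the right-`(A_G · G(K))`-invariant functions on `G(𝔸_K)`*;
the full group `G(𝔸_K)` acts continuously on the left, see `AutomorphicSpectrum`), its Borel
σ-algebra, and the measure bundle `AdelicGroupData.IsAutomorphicMeasure` (finite, positive on opens,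
inner regular, `G(𝔸_K)`-invariant).

## Design (outline D10, D11)

* **D10.** We quotient by `A_G · G(K)` with `A_G = ℝ_{>0}` embedded diagonally in the archimedean
  centre, *not* by the full centre and *not* by passing to `G(𝔸)¹`. The needed real structure is in
  Mathlib: `NumberField.InfiniteAdeleRing.ringEquiv_mixedSpace` identifies `K_∞` with
  `ℝ^{r₁} × ℂ^{r₂}`, an `ℝ`-algebra, whence `realToInfiniteAdele K : ℝ →+* K_∞`,
  `posRealIdele K : ℝ≥0ˣ →* 𝔸_Kˣ` (trivial finite component) and
  `posRealScalar n K : ℝ≥0ˣ →* GL n 𝔸_K` with an honest centrality proof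
  (`Matrix.GeneralLinearGroup.scalar_commute`).
* **D11.** One measure class `IsAutomorphicMeasure` extending `IsFiniteMeasure`,
  `IsOpenPosMeasure`, `InnerRegularCompactLTTop`, `SMulInvariantMeasure`; every parameter is
  determined by the type of `μ`, so the parent projections are sound instances.
* Honest instances: `AdelicGroupData.gl n K` (`GL_n`, Mathlib `Matrix.GeneralLinearGroup` over
  `NumberField.AdeleRing (𝓞 K) K`) and `AdelicGroupData.gl1 K` (ideles, Mathlib types only).
  This file has no dependencies inside H21 (review F10).
* Universe discipline: the fields `Rational`, `Adelic`, `Local v` live in `Type u` and the structure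
  in `Type (u + 1)`; the instances `gl`, `gl1` live in universe `0`.

Mathlib anchors used (all verified by grep): `NumberField.AdeleRing`,
`NumberField.InfiniteAdeleRing`, `InfiniteAdeleRing.ringEquiv_mixedSpace`, `NumberField.mixedEmbedding.mixedSpace`,
`IsDedekindDomain.FiniteAdeleRing` (a `RestrictedProduct`), `RestrictedProduct.evalRingHom`,
`RestrictedProduct.continuous_eval`, `Matrix.GeneralLinearGroup.map`,
`Matrix.GeneralLinearGroup.scalar`, `Matrix.GeneralLinearGroup.scalar_commute`,
`Continuous.generalLinearGroup_map`, `Units.continuous_map`, `MulEquiv.prodUnits`, `MonoidHom.inl`,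
`NNReal.toRealHom`, `QuotientGroup.instContinuousSMul`, `borel`, `SMulInvariantMeasure`,
`Measure.IsOpenPosMeasure`, `Measure.InnerRegularCompactLTTop`.

## References

* A. Borel, *Some finiteness properties of adele groups over number fields*, Publ. Math. IHÉS 16
  (1963), §5 (finite volume of `G(K) A_G \ G(𝔸)`).
* V. Platonov, A. Rapinchuk, *Algebraic groups and number theory*, Ch. 5.
* R. Godement, H. Jacquet, *Zeta functions of simple algebras*, LNM 260 (1972), §10.
-/

noncomputable section

open scoped NNReal
open NumberField IsDedekindDomain MeasureTheory Topology

universe u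

namespace Literature.NumberTheory.Automorphic

/-! ### Real scalars in the adeles (D10) -/

section RealScalars

variable (K : Type) [Field K] [NumberField K]

/-- The diagonal ring homomorphism `ℝ →+* K_∞ = ∏_{v ∣ ∞} K_v`, obtained by transporting the
`ℝ`-algebra structure of the mixed space `ℝ^{r₁} × ℂ^{r₂}` along Mathlib's
`InfiniteAdeleRing.ringEquiv_mixedSpace`. Informally `t ↦ (t, …, t)`.
(Outline D10; Platonov–Rapinchuk Ch. 5.) [folklore] -/
def realToInfiniteAdele : ℝ →+* InfiniteAdeleRing K :=
  (InfiniteAdeleRing.ringEquiv_mixedSpace K).symm.toRingHom.comp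
    (algebraMap ℝ (mixedEmbedding.mixedSpace K))

/-- The embedding `ℝ_{>0} →* 𝔸_Kˣ` of the positive reals into the ideles, diagonally at the
archimedean places and trivially at the finite places. Its image is the split component `A_G`
for `G = GL₁` (outline D10; Borel 1963 §5). [cite: Borel1963, §5] -/
def posRealIdele : ℝ≥0ˣ →* (AdeleRing (𝓞 K) K)ˣ :=
  (MulEquiv.prodUnits (M := InfiniteAdeleRing K)
        (N := FiniteAdeleRing (𝓞 K) K)).symm.toMonoidHom.comp
    ((MonoidHom.inl _ _).comp
      ((Units.map (realToInfiniteAdele K).toMonoidHom).comp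
        (Units.map NNReal.toRealHom.toMonoidHom)))

/-- The archimedean component of `posRealIdele K t` is the diagonal real scalar `t`
(outline D10). [folklore] -/
@[simp]
theorem posRealIdele_fst (t : ℝ≥0ˣ) :
    ((posRealIdele K t : (AdeleRing (𝓞 K) K)ˣ) : AdeleRing (𝓞 K) K).1 =
      realToInfiniteAdele K (t : ℝ≥0) := rfl

/-- The finite component of `posRealIdele K t` is trivial (outline D10). [folklore] -/
@[simp]
theorem posRealIdele_snd (t : ℝ≥0ˣ) :
    ((posRealIdele K t : (AdeleRing (𝓞 K) K)ˣ) : AdeleRing (𝓞 K) K).2 = 1 := rfl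

end RealScalars

/-- The embedding `ℝ_{>0} →* GL_n(𝔸_K)` as positive real scalar matrices at the archimedean
places (identity at finite places); its image is the split component `A_G` for `G = GL_n`
(outline D10; Borel 1963 §5; Godement–Jacquet LNM 260 §10). [cite: Borel1963, §5] -/
def posRealScalar (n : ℕ) (K : Type) [Field K] [NumberField K] :
    ℝ≥0ˣ →* GL (Fin n) (AdeleRing (𝓞 K) K) :=
  (Matrix.GeneralLinearGroup.scalar (Fin n)).comp (posRealIdele K)

/-- Positive real scalar matrices are central in `GL_n(𝔸_K)` (honest proof via
`Matrix.GeneralLinearGroup.scalar_commute`; outline D10). [folklore] -/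
theorem posRealScalar_mem_center (n : ℕ) (K : Type) [Field K] [NumberField K] (t : ℝ≥0ˣ) :
    posRealScalar n K t ∈ Subgroup.center (GL (Fin n) (AdeleRing (𝓞 K) K)) := by
  rw [Subgroup.mem_center_iff]
  intro g
  exact (Matrix.GeneralLinearGroup.scalar_commute _ g).symm

/-! ### The axiomatic global datum -/

/-- **Axiomatic adelic group datum** over a number field `K` (hypothesis structure; outline C9,
TRUNKS design 1(c)). It records, for a connected reductive group `G/K` one has in mind,
* `Rational` : the abstract group `G(K)`;
* `Adelic` : the topological group `G(𝔸_K)` and the diagonal map `toAdelic : G(K) →* G(𝔸_K)`;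
* `Local v` : the topological group `G(K_v)` at each finite place `v` of `K`, with the continuous
  projection `toLocal v : G(𝔸_K) →* G(K_v)`;
* `center'` : the *split central subgroup* `A_G ≤ Z(G(𝔸_K))` one quotients by to get a finite-volume
  automorphic quotient `G(K) A_G \ G(𝔸_K)` — in every instance `A_G = ℝ_{>0}` embedded in the
  archimedean centre (outline D10), **not** the full centre.

No axioms beyond `center'_le` are imposed here; properties such as discreteness of `G(K)` or finite
volume are separate predicates/theorems. (Borel 1963 §5; Platonov–Rapinchuk Ch. 5.) [cite: Borel1963, §5] -/
structure AdelicGroupData (K : Type) [Field K] [NumberField K] : Type (u + 1) where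
  /-- The group of rational points `G(K)`. -/
  Rational : Type u
  /-- The group of adelic points `G(𝔸_K)`. -/
  Adelic : Type u
  /-- `G(K)` is a group. -/
  [ratGroup : Group Rational]
  /-- `G(𝔸_K)` is a group. -/
  [adGroup : Group Adelic]
  /-- The adelic topology on `G(𝔸_K)`. -/
  [adTop : TopologicalSpace Adelic]
  /-- `G(𝔸_K)` is a topological group. -/
  [adTopGroup : IsTopologicalGroup Adelic]
  /-- The diagonal embedding `G(K) →* G(𝔸_K)`. -/
  toAdelic : Rational →* Adelic
  /-- The local group `G(K_v)` at a finite place `v`. -/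
  Local : IsDedekindDomain.HeightOneSpectrum (𝓞 K) → Type u
  /-- `G(K_v)` is a group. -/
  [locGroup : ∀ v, Group (Local v)]
  /-- The `v`-adic topology on `G(K_v)`. -/
  [locTop : ∀ v, TopologicalSpace (Local v)]
  /-- `G(K_v)` is a topological group. -/
  [locTopGroup : ∀ v, IsTopologicalGroup (Local v)]
  /-- The projection `G(𝔸_K) →* G(K_v)` onto the `v`-component. -/
  toLocal : ∀ v, Adelic →* Local v
  /-- The projections `G(𝔸_K) → G(K_v)` are continuous. -/
  continuous_toLocal : ∀ v, Continuous (toLocal v)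
  /-- The split central subgroup `A_G` (in instances: `ℝ_{>0}` in the archimedean centre) that the
  automorphic quotient `G(K) A_G \ G(𝔸_K)` divides out (outline D10). -/
  center' : Subgroup Adelic
  /-- `A_G` is central in `G(𝔸_K)`. -/
  center'_le : center' ≤ Subgroup.center Adelic

namespace AdelicGroupData

attribute [instance] ratGroup adGroup adTop adTopGroup locGroup locTop locTopGroup

variable {K : Type} [Field K] [NumberField K] (𝒢 : AdelicGroupData.{u} K)

/-- The arithmetic subgroup `G(K) ≤ G(𝔸_K)`: the image of the diagonal embedding `toAdelic`
(Borel 1963 §5). [cite: Borel1963, §5] -/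
def arithmeticSubgroup : Subgroup 𝒢.Adelic := 𝒢.toAdelic.range

/-- The subgroup `A_G · G(K) ≤ G(𝔸_K)` one quotients by to form the automorphic quotient
(outline D10; Borel 1963 §5). Since `A_G` is central this is the join `A_G ⊔ G(K)`. [cite: Borel1963, §5] -/
def quotientSubgroup : Subgroup 𝒢.Adelic := 𝒢.center' ⊔ 𝒢.arithmeticSubgroup

/-- `A_G ≤ A_G · G(K)` (outline D10). [folklore] -/
theorem center'_le_quotientSubgroup : 𝒢.center' ≤ 𝒢.quotientSubgroup := le_sup_left

/-- `G(K) ≤ A_G · G(K)` (outline D10). [folklore] -/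
theorem arithmeticSubgroup_le_quotientSubgroup : 𝒢.arithmeticSubgroup ≤ 𝒢.quotientSubgroup :=
  le_sup_right

/-- The **automorphic quotient** `G(𝔸_K) ⧸ (A_G · G(K))`, as a left-coset space in Mathlib's
convention `G ⧸ H` (so functions on it are the *right*-`A_G G(K)`-invariant functions on `G(𝔸_K)`,
and `G(𝔸_K)` acts on the left). Classically written `G(K) A_G \ G(𝔸_K)` after `g ↦ g⁻¹`.
(Outline D10; Borel 1963 §5; Godement–Jacquet LNM 260 §10.) [cite: Borel1963, §5] -/
def automorphicQuotient : Type u := 𝒢.Adelic ⧸ 𝒢.quotientSubgroup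

/-- The quotient topology on the automorphic quotient (Mathlib `QuotientGroup` instance). [folklore] -/
instance instTopologicalSpaceAutomorphicQuotient : TopologicalSpace 𝒢.automorphicQuotient :=
  inferInstanceAs (TopologicalSpace (𝒢.Adelic ⧸ 𝒢.quotientSubgroup))

/-- The left action of `G(𝔸_K)` on the automorphic quotient `G(𝔸_K) ⧸ (A_G · G(K))`
(Mathlib `MulAction G (G ⧸ H)`); adelic Hecke operators act through it (outline D10). [folklore] -/
instance instMulActionAutomorphicQuotient : MulAction 𝒢.Adelic 𝒢.automorphicQuotient :=
  inferInstanceAs (MulAction 𝒢.Adelic (𝒢.Adelic ⧸ 𝒢.quotientSubgroup))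

/-- Each `g ∈ G(𝔸_K)` acts by a homeomorphism of the automorphic quotient
(Mathlib `QuotientGroup.instContinuousConstSMul`). [folklore] -/
instance instContinuousConstSMulAutomorphicQuotient :
    ContinuousConstSMul 𝒢.Adelic 𝒢.automorphicQuotient :=
  inferInstanceAs (ContinuousConstSMul 𝒢.Adelic (𝒢.Adelic ⧸ 𝒢.quotientSubgroup))

/-- The action `G(𝔸_K) × (G(𝔸_K) ⧸ A_G G(K)) → G(𝔸_K) ⧸ A_G G(K)` is jointly continuous
(Mathlib `QuotientGroup.instContinuousSMul`). [folklore] -/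
instance instContinuousSMulAutomorphicQuotient :
    ContinuousSMul 𝒢.Adelic 𝒢.automorphicQuotient :=
  inferInstanceAs (ContinuousSMul 𝒢.Adelic (𝒢.Adelic ⧸ 𝒢.quotientSubgroup))

/-- The Borel σ-algebra on the automorphic quotient (Mathlib `borel`). [folklore] -/
instance instMeasurableSpaceAutomorphicQuotient : MeasurableSpace 𝒢.automorphicQuotient :=
  borel _

/-- The σ-algebra on the automorphic quotient is the Borel one, by definition. [folklore] -/
instance instBorelSpaceAutomorphicQuotient : BorelSpace 𝒢.automorphicQuotient := ⟨rfl⟩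

/-- The quotient map `G(𝔸_K) → G(𝔸_K) ⧸ (A_G · G(K))` (Mathlib `QuotientGroup.mk`). [folklore] -/
def toAutomorphicQuotient : 𝒢.Adelic → 𝒢.automorphicQuotient := QuotientGroup.mk

/-- The quotient map to the automorphic quotient is continuous (Mathlib
`QuotientGroup.continuous_mk`). [folklore] -/
theorem continuous_toAutomorphicQuotient : Continuous 𝒢.toAutomorphicQuotient :=
  QuotientGroup.continuous_mk

/-- `G(K)` is discrete in `G(𝔸_K)`: the arithmetic subgroup carries the discrete topology.
This is a theorem for linear algebraic groups (Borel 1963 §5; Platonov–Rapinchuk Ch. 5) and an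
axiom-free predicate on the abstract datum. [cite: Borel1963, §5] -/
def IsDiscreteRational : Prop := DiscreteTopology 𝒢.arithmeticSubgroup

/-! ### The measure bundle (D11) -/

/-- **Automorphic measures** on `G(𝔸_K) ⧸ (A_G · G(K))` (outline D11): a measure `μ` which is
finite (Borel–Harish-Chandra finiteness of volume, Borel 1963 §5), positive on non-empty open sets,
inner regular with respect to compact sets on sets of finite measure, and invariant under the left
action of `G(𝔸_K)`. These four conditions exclude every junk choice (`0`, `∞ • Haar`, counting
measure) and pin `μ` down up to a positive scalar (`isAutomorphicMeasure_unique_smul`); every `L²`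
statement of the trunk assumes exactly `[𝒢.IsAutomorphicMeasure μ]`. All parameters of the parent
classes are determined by the type of `μ`, so the parent projections are sound instances. [cite: Borel1963, §5] -/
class IsAutomorphicMeasure (𝒢 : AdelicGroupData.{u} K) (μ : Measure 𝒢.automorphicQuotient) : Prop
    extends IsFiniteMeasure μ, μ.IsOpenPosMeasure, μ.InnerRegularCompactLTTop,
      SMulInvariantMeasure 𝒢.Adelic 𝒢.automorphicQuotient μ

example (μ : Measure 𝒢.automorphicQuotient) [𝒢.IsAutomorphicMeasure μ] : IsFiniteMeasure μ :=
  inferInstance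
example (μ : Measure 𝒢.automorphicQuotient) [𝒢.IsAutomorphicMeasure μ] : μ.IsOpenPosMeasure :=
  inferInstance
example (μ : Measure 𝒢.automorphicQuotient) [𝒢.IsAutomorphicMeasure μ] :
    μ.InnerRegularCompactLTTop := inferInstance
example (μ : Measure 𝒢.automorphicQuotient) [𝒢.IsAutomorphicMeasure μ] :
    SMulInvariantMeasure 𝒢.Adelic 𝒢.automorphicQuotient μ := inferInstance

/-! ### Honest instances: `GL_n` and `GL₁` -/

section Instances

variable (n : ℕ) (K : Type) [Field K] [NumberField K]

/-- The projection of the finite adele ring `𝔸_K^∞ = ∏'_v K_v` (a `RestrictedProduct` in Mathlib)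
onto its `v`-component (Mathlib `RestrictedProduct.evalRingHom`, specialised). [folklore] -/
def finiteAdeleEval (v : HeightOneSpectrum (𝓞 K)) :
    FiniteAdeleRing (𝓞 K) K →+* v.adicCompletion K :=
  RestrictedProduct.evalRingHom
    (R := fun w : HeightOneSpectrum (𝓞 K) ↦ w.adicCompletion K)
    (B := fun w : HeightOneSpectrum (𝓞 K) ↦ w.adicCompletionIntegers K) v

/-- `finiteAdeleEval K v x = x v` (definitional). [folklore] -/
@[simp]
theorem finiteAdeleEval_apply (v : HeightOneSpectrum (𝓞 K)) (x : FiniteAdeleRing (𝓞 K) K) :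
    finiteAdeleEval K v x = x v := rfl

/-- The projection `𝔸_K^∞ → K_v` is continuous (Mathlib `RestrictedProduct.continuous_eval`). [folklore] -/
theorem continuous_finiteAdeleEval (v : HeightOneSpectrum (𝓞 K)) :
    Continuous (finiteAdeleEval K v) :=
  RestrictedProduct.continuous_eval v

/-- The projection `𝔸_K →+* K_v` of the adele ring onto its component at a finite place `v`
(Mathlib `RingHom.snd` followed by `finiteAdeleEval`). [folklore] -/
def adeleEval (v : HeightOneSpectrum (𝓞 K)) : AdeleRing (𝓞 K) K →+* v.adicCompletion K :=
  (finiteAdeleEval K v).comp (RingHom.snd _ _)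

/-- `adeleEval K v x = x.2 v` (definitional). [folklore] -/
@[simp]
theorem adeleEval_apply (v : HeightOneSpectrum (𝓞 K)) (x : AdeleRing (𝓞 K) K) :
    adeleEval K v x = x.2 v := rfl

/-- The projection `𝔸_K → K_v` is continuous. [folklore] -/
theorem continuous_adeleEval (v : HeightOneSpectrum (𝓞 K)) : Continuous (adeleEval K v) :=
  (continuous_finiteAdeleEval K v).comp continuous_snd

/-- The adelic group datum of `GL_n` over `K` (honest instance; outline C9):
`Rational := GL_n(K)`, `Adelic := GL_n(𝔸_K)` (Mathlib `Matrix.GeneralLinearGroup` over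
`NumberField.AdeleRing (𝓞 K) K` with its units topology), `Local v := GL_n(K_v)`,
`toLocal v` induced by `𝔸_K → K_v`, and `center' := A_G = ℝ_{>0}` embedded as positive real
scalars at infinity (`posRealScalar`). (Borel 1963 §5; Godement–Jacquet LNM 260 §10.) [cite: Borel1963, §5] -/
def gl : AdelicGroupData.{0} K where
  Rational := GL (Fin n) K
  Adelic := GL (Fin n) (AdeleRing (𝓞 K) K)
  toAdelic := Matrix.GeneralLinearGroup.map (algebraMap K (AdeleRing (𝓞 K) K))
  Local v := GL (Fin n) (v.adicCompletion K)
  toLocal v := Matrix.GeneralLinearGroup.map (adeleEval K v)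
  continuous_toLocal v := (continuous_adeleEval K v).generalLinearGroup_map
  center' := (posRealScalar n K).range
  center'_le := by
    rintro _ ⟨t, rfl⟩
    exact posRealScalar_mem_center n K t

/-- The adelic group datum of `GL₁` over `K` with Mathlib types only (honest instance; outline C9):
`Rational := Kˣ`, `Adelic := 𝔸_Kˣ` (the idele group), `Local v := K_vˣ`, and
`center' := ℝ_{>0}` (`posRealIdele`). Its automorphic quotient is
`𝔸_Kˣ ⧸ (ℝ_{>0} · Kˣ) ≅ C_K / ℝ_{>0} ≅ C_K¹`, the norm-one idele class group (compact); the
comparison is proved in `IdeleClassGroup`. (Borel 1963 §5; Platonov–Rapinchuk Ch. 5.) [cite: Borel1963, §5] -/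
def gl1 : AdelicGroupData.{0} K where
  Rational := Kˣ
  Adelic := (AdeleRing (𝓞 K) K)ˣ
  toAdelic := Units.map (algebraMap K (AdeleRing (𝓞 K) K)).toMonoidHom
  Local v := (v.adicCompletion K)ˣ
  toLocal v := Units.map (adeleEval K v).toMonoidHom
  continuous_toLocal v := Units.continuous_map (continuous_adeleEval K v)
  center' := (posRealIdele K).range
  center'_le x _ := Subgroup.mem_center_iff.mpr fun g ↦ mul_comm g x

/-- `(gl n K).Adelic` is `GL_n(𝔸_K)` (definitional). [folklore] -/
@[simp] theorem gl_Adelic : (gl n K).Adelic = GL (Fin n) (AdeleRing (𝓞 K) K) := rfl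
/-- `(gl n K).Rational` is `GL_n(K)` (definitional). [folklore] -/
@[simp] theorem gl_Rational : (gl n K).Rational = GL (Fin n) K := rfl
/-- `(gl n K).center'` is `A_G = posRealScalar`-image of `ℝ_{>0}` (definitional; D10). [folklore] -/
@[simp] theorem gl_center' : (gl n K).center' = (posRealScalar n K).range := rfl
/-- `(gl1 K).Adelic` is the idele group `𝔸_Kˣ` (definitional). [folklore] -/
@[simp] theorem gl1_Adelic : (gl1 K).Adelic = (AdeleRing (𝓞 K) K)ˣ := rfl
/-- `(gl1 K).center'` is the image of `ℝ_{>0}` in the ideles (definitional; D10). [folklore] -/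
@[simp] theorem gl1_center' : (gl1 K).center' = (posRealIdele K).range := rfl

/-- `GL_n(K)` is discrete in `GL_n(𝔸_K)` (Borel 1963 §5; Platonov–Rapinchuk Ch. 5, discreteness of
`K` in `𝔸_K` plus the closed embedding `GL_n ↪ M_n × M_n`). [cite: Borel1963, §5] -/
def gl_isDiscreteRational : Prop :=
  (gl n K).IsDiscreteRational

/-- `ℝ_{>0} · GL_n(K)` is a closed subgroup of `GL_n(𝔸_K)` (Borel 1963 §5): `GL_n(K)` is discrete,
`A_G` is closed, and `A_G ∩ GL_n(K) = 1`. [cite: Borel1963, §5] -/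
def isClosed_quotientSubgroup_gl : Prop :=
  IsClosed ((gl n K).quotientSubgroup : Set (gl n K).Adelic)

/-- `GL_n(𝔸_K)` is locally compact (Platonov–Rapinchuk Ch. 5: `𝔸_K` is a locally compact ring and
`GL_n ↪ M_n × M_n` is a closed embedding). [cite: PlatonovRapinchuk1994, §5.1 (adele groups are locally compact)] -/
def locallyCompactSpace_gl_adelic : Prop :=
  LocallyCompactSpace (gl n K).Adelic

/-- The automorphic quotient `GL_n(𝔸_K) ⧸ (ℝ_{>0} · GL_n(K))` is Hausdorff (quotient of a
topological group by a closed subgroup; Borel 1963 §5). [cite: Borel1963, §5] -/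
def t2Space_automorphicQuotient_gl : Prop :=
  T2Space (gl n K).automorphicQuotient

/-- **Borel–Harish-Chandra finiteness** for `GL_n`: the automorphic quotient
`GL_n(𝔸_K) ⧸ (ℝ_{>0} · GL_n(K))` carries a finite, `GL_n(𝔸_K)`-invariant Radon measure of full
support (Borel 1963, Thm. 5.8; Godement–Jacquet LNM 260 §10). [cite: Borel1963, Thm. 5.8] -/
def exists_isAutomorphicMeasure_gl : Prop :=
  ∃ μ : Measure (gl n K).automorphicQuotient, (gl n K).IsAutomorphicMeasure μ

/-- Uniqueness of the automorphic measure on `GL_n(𝔸_K) ⧸ (ℝ_{>0} · GL_n(K))` up to a positive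
scalar (uniqueness of invariant Radon measures on homogeneous spaces of locally compact groups;
Borel 1963 §5). [cite: Borel1963, §5] -/
def isAutomorphicMeasure_unique_smul : Prop :=
  ∀ (μ ν : Measure (gl n K).automorphicQuotient) [(gl n K).IsAutomorphicMeasure μ] [(gl n K).IsAutomorphicMeasure ν],
    ∃ c : ℝ≥0, c ≠ 0 ∧ μ = c • ν

/-- For `n = 1` the automorphic quotient `𝔸_Kˣ ⧸ (ℝ_{>0} · Kˣ) ≅ C_K¹` is compact
(compactness of the norm-one idele class group; Platonov–Rapinchuk Ch. 5, Borel 1963 §5). [cite: Borel1963, §5] -/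
def compactSpace_automorphicQuotient_gl_one : Prop :=
  CompactSpace (gl 1 K).automorphicQuotient

end Instances

end AdelicGroupData

end Literature.NumberTheory.Automorphic
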